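import Summits.BirchSwinnertonDyer.BirchSwinnertonDyer.Theorems.RamifiedSevenEllipticUnitsDeuringShapeOfPinned
import HarnessLib

set_option linter.dupNamespace false
set_option autoImplicit false

/-!
# Crux `PrintCf2.SplitBadTwoRankOneOfFacts` (stmt-BirchSwinnertonDyer-20368), road α — FRAME PINNING, I:
# the Hecke character of a Katz frame is UNIQUE, conj-equivariant, and RAMIFIED at both places above `2`

Width seat `bsd-line-cf2-p1-w6` (brick B8 «pinning lemma» of the planner's WIDTH BRICK MENU, 2026-08-28).
Helper `--supports` stmt-BirchSwinnertonDyer-20368; THEOREMS ONLY (no `def`, no named fact, no `sorry`).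

WHAT. The research stubs S2′ `stub_rubinValueFormula_two` / S3b `stub_ellipticUnitDescent_two` of the
registered skeleton (v8 `18fa9a3c83355c23`) quantify over an ARBITRARY frame: an imaginary quadratic `K`
with `2 = v·v̄` split, a non-trivial `c ∈ Aut(K/ℚ)`, and ANY Hecke character `ψ` of `K` of infinity
type `(1, 0)` with `heckeLFunction ψ s = W.LSeries s` on `re s > 3/2` (`W ≅ cm7^{(d)}`, `d ≢ 1 (mod 4)`
squarefree). Width seat -w3 g4 flagged that identifying `ψ` («`ψ = ψ_A·χ_d∘N`») "needs strong
multiplicity one for Hecke `L`-series, not in the tree". FINDING: it IS in the tree — cell `bsd-cm`'s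
kernel theorem `RamifiedSevenEllipticUnits.Rigidity.eq_or_eq_galConj_of_heckeLFunction_eq` (two Hecke
characters of an imaginary quadratic field with the same `L`-function on a right half-plane, one of type
`(1,0)`, are equal or `c`-conjugate). This file turns it into the frame-currency statements road α uses:

* §1 `eq_of_heckeLFunction_eq` / `eq_of_pinned` — **UNIQUENESS**: two Hecke characters of infinity type
  `(1, 0)` of an imaginary quadratic field with the same `L`-function (in particular both `L`-pinned to
  the same curve) are EQUAL — the `c`-conjugate alternative is excluded because `ψ ∘ c` has infinity type
  `(0, 1)`: `ψ((x)_∞) = σ(x)⁻¹` but `(ψ∘c)((x)_∞) = σ(c x)⁻¹`, and `σ ∘ c ≠ σ`.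
* §2 `not_isUnramifiedAt_of_pinned_of_lFunction_eq_zero` — **RAMIFICATION AT AN ADDITIVE PRIME UNRAMIFIED
  IN `K`** (the split and inert cases; the ramified case `p ∣ d_K` is bsd-cm's
  `Rigidity.not_isUnramifiedAt_of_heckeLFunction_eq_LSeries_of_lFunction_eq_zero`): if `a_p(V) = a_{p²}(V) = 0`
  (e.g. `V/ℚ` additive at `p`) and `p ∤ d_K`, EVERY Hecke character pinned to `V` is ramified at every
  place above `p` (coefficient identity `a_n(V) = (Σ_{N𝔞=n} ψ₀(𝔞)) n^{−σ}` at `n = p, p²`: split,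
  `x₁ + x₂ = 0 = x₁² + x₁x₂ + x₂²` forces `x₁ = x₂ = 0`; inert, `x = a_{p²} = 0`; and `ψ₀(𝔭) ≠ 0` at an
  unramified place).
* the 20368 frame itself (`W` additive at `2`, `ψ` ramified at `v` and `v̄`, `c • v = v̄`, `c • S = S`, the
  package `framePinning_two`) is the sequel file `PrintCf2SplitBadTwoFramePinningAtTwo.lean`.

HONEST FRAMING: kernel theorems about Hecke characters and reduction types; nothing is claimed about BSD;
no stub of the skeleton is closed by this file; 20368 stays OPEN. beyond-print theorem: no.

References: [NeukirchANT1999] VII §6 (6.9), (6.13), §8 (8.1); [SilvermanATAEC1994] II Thm. 9.2, 10.5;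
[BarriosEtAl2025] Thm. 5.1 rows `I₀`; [SilvermanAEC2009] VII.5 Prop. 5.1, App. C §16.
-/

noncomputable section

open scoped Classical
open Filter NumberField IsDedekindDomain WeierstrassCurve
  Literature.NumberTheory.GaloisRepresentations
  Literature.NumberTheory.LFunctions
  Literature.NumberTheory.EllipticCurves
  Literature.NumberTheory.EllipticCurves.ModularForms
  Summit.BirchSwinnertonDyer.BirchSwinnertonDyer.Theorems.RamifiedSevenEllipticUnits

namespace Summit.BirchSwinnertonDyer.BirchSwinnertonDyer.Theorems.PrintCf2.FramePinning

variable {K : Type} [Field K] [NumberField K]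

/-! ## §1 Uniqueness of the pinned character of infinity type `(1, 0)` -/

/-- **A `(1,0)` character is never the `c`-conjugate of a `(1,0)` character** (`c ≠ 1`): the conjugate
`ψ ∘ c` has infinity type `(0,1)`. Read at the principal infinite ideles: `φ((x)_∞) = σ(x)⁻¹` and
`(ψ ∘ c)((x)_∞) = ψ((c x)_∞) = σ(c x)⁻¹`, so `φ = ψ ∘ c` would give `σ ∘ c = σ` on `Kˣ`, i.e. `c = 1`.
[cite: NeukirchANT1999, Ch. VII §6 Prop. (6.9) (the infinity component of a Größencharakter)] -/
theorem ne_galConj_of_hasInfinityType (hK : IsImaginaryQuadratic K) {c : K ≃ₐ[ℚ] K} (hc : c ≠ 1)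
    {φ ψ : HeckeCharacter K} (hφ : φ.HasInfinityType (fun _ ↦ 1) (fun _ ↦ 0))
    (hψ : ψ.HasInfinityType (fun _ ↦ 1) (fun _ ↦ 0)) : φ ≠ HeckeCharacter.galConj c ψ := by
  intro h
  haveI : IsTotallyComplex K := hK.2
  obtain ⟨w₀⟩ : Nonempty (InfinitePlace K) := inferInstance
  have key : ∀ x : Kˣ, w₀.embedding (c (x : K)) = w₀.embedding (x : K) := fun x ↦ by
    have h1 := Rigidity.coe_apply_infiniteIdeles_eq_of_hasInfinityType_one_zero hK w₀ hφ x
    rw [h, HeckeCharacter.galConj_apply, Rigidity.smul_infiniteIdeles_globalToInfiniteUnits,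
      Rigidity.coe_apply_infiniteIdeles_eq_of_hasInfinityType_one_zero hK w₀ hψ] at h1
    have h2 := inv_injective h1
    simpa using h2
  apply hc
  ext x
  rcases eq_or_ne x 0 with rfl | hx
  · simp
  · exact w₀.embedding.injective (key (Units.mk0 x hx))

/-- **UNIQUENESS of `(1,0)` characters with a given `L`-function.** `K` imaginary quadratic; `φ`, `ψ`
Hecke characters of `K` of infinity type `(1, 0)` with `heckeLFunction φ s = heckeLFunction ψ s` for
`re s > s₀`. Then `φ = ψ`. (Strong multiplicity one — bsd-cm's kernel theorem
`Rigidity.eq_or_eq_galConj_of_heckeLFunction_eq`: `φ = ψ` or `φ = ψ ∘ c` — and `ne_galConj_of_hasInfinityType`.)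
[cite: NeukirchANT1999, Ch. VII §6 Prop. (6.13) and §8 (8.1)] [cite: Ribet1977Nebentypus, §3 Thm. (3.4)] -/
theorem eq_of_heckeLFunction_eq (hK : IsImaginaryQuadratic K) {φ ψ : HeckeCharacter K}
    (hφ : φ.HasInfinityType (fun _ ↦ 1) (fun _ ↦ 0)) (hψ : ψ.HasInfinityType (fun _ ↦ 1) (fun _ ↦ 0))
    (s₀ : ℝ) (h : ∀ s : ℂ, s₀ < s.re → heckeLFunction φ s = heckeLFunction ψ s) : φ = ψ := by
  obtain ⟨c, hc⟩ := QuadraticRamification.exists_algEquiv_ne_one_of_finrank_eq_two hK.1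
  rcases Rigidity.eq_or_eq_galConj_of_heckeLFunction_eq hK c hc hψ s₀ h with h | h
  · exact h
  · exact absurd h (ne_galConj_of_hasInfinityType hK hc hφ hψ)

/-- **UNIQUENESS OF THE PINNED CHARACTER OF A FRAME.** `K` imaginary quadratic, `V` a Weierstrass curve
over any number field, `φ`, `ψ` Hecke characters of `K` of infinity type `(1, 0)` BOTH pinned to `V`
(`heckeLFunction · s = V.LSeries s` for `re s > s₀`). Then `φ = ψ`: the character of a Katz frame of the
20368 skeleton is determined by the frame field alone. [cite: SilvermanATAEC1994, Ch. II Thm. 10.5 (the character with L(E,s) = L(ψ,s); here its uniqueness)]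
[cite: NeukirchANT1999, Ch. VII §6 Prop. (6.13), §8 (8.1)] -/
theorem eq_of_pinned (hK : IsImaginaryQuadratic K) {φ ψ : HeckeCharacter K}
    (hφ : φ.HasInfinityType (fun _ ↦ 1) (fun _ ↦ 0)) (hψ : ψ.HasInfinityType (fun _ ↦ 1) (fun _ ↦ 0))
    {F : Type} [Field F] [NumberField F] (V : WeierstrassCurve F) (s₀ : ℝ)
    (hφL : ∀ s : ℂ, s₀ < s.re → heckeLFunction φ s = V.LSeries s)
    (hψL : ∀ s : ℂ, s₀ < s.re → heckeLFunction ψ s = V.LSeries s) : φ = ψ :=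
  eq_of_heckeLFunction_eq hK hφ hψ s₀ fun s hs ↦ by rw [hφL s hs, hψL s hs]

/-! ## §2 Ramification of a pinned character at an additive prime unramified in `K` -/

/-- **A pinned character is RAMIFIED above a prime `p ∤ d_K` with `a_p(V) = a_{p²}(V) = 0`.** `K`
quadratic, `p` a prime with `p ∤ d_K` (so `p` is split or inert in `K`), `V` a Weierstrass curve over a
number field whose Dirichlet coefficients at `p` and `p²` vanish (e.g. `V/ℚ` with additive reduction at
`p`), and `ψ` ANY Hecke character of `K` with `heckeLFunction ψ s = V.LSeries s` for `re s > s₀`. Then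
`ψ` is ramified at every place `w ∣ p`. MECHANISM: with Weil's decomposition `ψ = ψ₀‖·‖^{−σ}` and the
ideal function `g` of `ψ₀` (`g(𝔭_w) = ψ₀(ϖ_w) ≠ 0` iff `ψ` is unramified at `w`), the pinning reads
`a_n(V) = (Σ_{N𝔞 = n} g(𝔞)) n^{−σ}` (bsd-cm's `Rigidity.intCast_lFunction_eq_weightedCoeff_of_heckeLFunction_eq_LSeries`);
split `p = w₁w₂`: `g(w₁) + g(w₂) = 0` and `g(w₁)² + g(w₁)g(w₂) + g(w₂)² = 0` give `g(w₁)² = 0`, so both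
vanish; inert: `g(w) = a_{p²}·p^{2σ} = 0`. Unconditional; complements the ramified-prime case
`Rigidity.not_isUnramifiedAt_of_heckeLFunction_eq_LSeries_of_lFunction_eq_zero`.
[cite: NeukirchANT1999, Ch. VII §8 (8.1)] [cite: SilvermanAEC2009, App. C §16 (local factor 1 at an additive prime)] -/
theorem not_isUnramifiedAt_of_pinned_of_lFunction_eq_zero (h2 : Module.finrank ℚ K = 2)
    {ψ : HeckeCharacter K} {F : Type} [Field F] [NumberField F] (V : WeierstrassCurve F) (s₀ : ℝ)
    (hpin : ∀ s : ℂ, s₀ < s.re → heckeLFunction ψ s = V.LSeries s)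
    {p : ℕ} [hp : Fact p.Prime] (hnd : ¬ (p : ℤ) ∣ NumberField.discr K)
    (hV₁ : V.LFunction p = 0) (hV₂ : V.LFunction (p ^ 2) = 0)
    (w : HeightOneSpectrum (𝓞 K)) (hw : ((p : ℕ) : 𝓞 K) ∈ w.asIdeal) : ¬ ψ.IsUnramifiedAt w := by
  -- the rational place `v = (p)` under `w`, unramified in `K`
  set v : HeightOneSpectrum (𝓞 ℚ) := w.under (𝓞 ℚ) with hv
  have hwv : w.asIdeal.under (𝓞 ℚ) = v.asIdeal := rfl
  have hgen : Rat.HeightOneSpectrum.natGenerator v = p := natGenerator_under_eq_of_natCast_mem w hp.out hw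
  have he : v.asIdeal.ramificationIdxIn (𝓞 K) = 1 :=
    ramificationIdxIn_eq_one_of_not_dvd_discr (K := K) v (by rw [hgen]; exact hnd)
  have hp0 : (p : ℂ) ≠ 0 := by exact_mod_cast hp.out.ne_zero
  -- Weil decomposition and the coefficient identity
  obtain ⟨σ, ψ₀, 𝔪, hu, h𝔪, hiff, -, -, hcoeff⟩ :=
    Rigidity.intCast_lFunction_eq_weightedCoeff_of_heckeLFunction_eq_LSeries ψ V s₀ hpin
  set g : Ideal (𝓞 K) →*₀ ℂ := rayClassCoeffHom 𝔪 fun v ↦ ψ₀.valueAtUniformizer v with hg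
  have hmul : ∀ A B : Ideal (𝓞 K), A ≠ ⊥ → B ≠ ⊥ → g (A * B) = g A * g B := fun A B _ _ ↦ map_mul g A B
  have hone : g ⊤ = 1 := by rw [← Ideal.one_eq_top, map_one]
  -- an unramified place has a NON-ZERO coefficient (`ψ₀` is unitary)
  have hne_of : ∀ w' : HeightOneSpectrum (𝓞 K), ψ.IsUnramifiedAt w' → g w'.asIdeal ≠ 0 := by
    intro w' hw' h0
    rw [hg, Rigidity.rayClassCoeffHom_asIdeal _ ((hiff w').mp hw') h𝔪] at h0
    have h1 := HeckeCharacter.norm_valueAtUniformizer_of_isUnitary hu w'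
    rw [h0, norm_zero] at h1
    exact zero_ne_one h1
  -- `u = p^σ ≠ 0`
  set u : ℂ := (p : ℂ) ^ (σ : ℂ) with huu
  have hu0 : u ≠ 0 := fun h0 ↦ hp0 ((Complex.cpow_eq_zero_iff _ _).mp h0).1
  have hw1 : ((p : ℕ) : ℂ) ^ (-(σ : ℂ)) = u⁻¹ := Complex.cpow_neg _ _
  have hw2 : ((p ^ 2 : ℕ) : ℂ) ^ (-(σ : ℂ)) = u⁻¹ * u⁻¹ := by
    rw [pow_two, Nat.cast_mul, Complex.natCast_mul_natCast_cpow, Complex.cpow_neg]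
  -- the two coefficients vanish, hence so do the two twisted counts
  have e1 := hcoeff p hp.out.ne_zero
  have e2 := hcoeff (p ^ 2) (pow_ne_zero 2 hp.out.ne_zero)
  rw [hV₁, Int.cast_zero, hw1] at e1
  rw [hV₂, Int.cast_zero, hw2] at e2
  have t1 : NumberField.twistCount K g p = 0 := by
    rcases mul_eq_zero.mp e1.symm with h | h
    · exact h
    · exact absurd h (inv_ne_zero hu0)
  have t2 : NumberField.twistCount K g (p ^ 2) = 0 := by
    rcases mul_eq_zero.mp e2.symm with h | h
    · exact h
    · exact absurd h (mul_ne_zero (inv_ne_zero hu0) (inv_ne_zero hu0))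
  intro hunr
  rcases exists_places_eq_pair_or_eq_singleton h2 v he with
    ⟨w₁, w₂, hne, hS, h₁, h₂⟩ | ⟨w₀, hS, hw₀⟩
  · -- SPLIT: `x₁ + x₂ = 0`, `x₂² + x₁ x₂ + x₁² = 0` ⟹ `x₁ = x₂ = 0`
    have hsum : ∀ e : ℕ, NumberField.twistCount K g (p ^ e) =
        ∑ i ∈ Finset.range (e + 1), g w₁.asIdeal ^ i * g w₂.asIdeal ^ (e - i) := by
      intro e
      rw [Rigidity.twistCount_eq_finsum, ← hgen]
      exact finsum_absNorm_eq_prime_pow_of_pair g hmul hone v hne hS h₁ h₂ e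
    have hs1 : NumberField.twistCount K g p = g w₂.asIdeal + g w₁.asIdeal := by
      have h := hsum 1
      rw [pow_one] at h
      rw [h, Finset.sum_range_succ, Finset.sum_range_succ, Finset.sum_range_zero]
      simp
    have hs2 : NumberField.twistCount K g (p ^ 2) =
        g w₂.asIdeal ^ 2 + g w₁.asIdeal * g w₂.asIdeal + g w₁.asIdeal ^ 2 := by
      rw [hsum 2, Finset.sum_range_succ, Finset.sum_range_succ, Finset.sum_range_succ,
        Finset.sum_range_zero]
      simp
    rw [hs1] at t1
    rw [hs2] at t2
    have hx₁ : g w₁.asIdeal = 0 := by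
      have h : g w₁.asIdeal ^ 2 = 0 := by linear_combination t2 - g w₂.asIdeal * t1
      exact pow_eq_zero_iff two_ne_zero |>.mp h
    have hx₂ : g w₂.asIdeal = 0 := by linear_combination t1 - hx₁
    have hwS : w ∈ ({w₁, w₂} : Set (HeightOneSpectrum (𝓞 K))) := by rw [← hS]; exact hwv
    rcases hwS with rfl | rfl
    · exact hne_of _ hunr hx₁
    · exact hne_of _ hunr hx₂
  · -- INERT: `x = a_{p²}·p^{2σ} = 0`
    have hw' : w = w₀ := by
      have : w ∈ ({w₀} : Set (HeightOneSpectrum (𝓞 K))) := by rw [← hS]; exact hwv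
      simpa using this
    subst hw'
    have hs2 : NumberField.twistCount K g (p ^ 2) = g w.asIdeal := by
      have h := (finsum_absNorm_eq_prime_pow_of_singleton g hmul hone v hS hw₀ 1).1
      rw [hgen, show 2 * 1 = 2 from rfl, pow_one] at h
      rw [Rigidity.twistCount_eq_finsum]
      exact h
    rw [hs2] at t2
    exact hne_of _ hunr t2

/-- **A pinned character is RAMIFIED above an ADDITIVE prime `p ∤ d_K` of a curve over `ℚ`**: for `V/ℚ`
elliptic with additive reduction at the place `v_p` over `p`, `a_p(V) = a_{p²}(V) = 0` (the local Euler
factor is `1`, tree `LFunction_apply_eq_zero_of_hasAdditiveReductionAt`), so §2 applies.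
[cite: SilvermanAEC2009, VII.5 Prop. 5.1 and App. C §16] [cite: NeukirchANT1999, Ch. VII §8 (8.1)] -/
theorem not_isUnramifiedAt_of_pinned_of_hasAdditiveReductionAt (h2 : Module.finrank ℚ K = 2)
    {ψ : HeckeCharacter K} (V : WeierstrassCurve ℚ) [V.IsElliptic] (s₀ : ℝ)
    (hpin : ∀ s : ℂ, s₀ < s.re → heckeLFunction ψ s = V.LSeries s)
    {p : ℕ} [Fact p.Prime] (hnd : ¬ (p : ℤ) ∣ NumberField.discr K)
    {vp : HeightOneSpectrum (𝓞 ℚ)} (hvp : (Rat.HeightOneSpectrum.primesEquiv vp : ℕ) = p)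
    (hadd : V.HasAdditiveReductionAt vp)
    (w : HeightOneSpectrum (𝓞 K)) (hw : ((p : ℕ) : 𝓞 K) ∈ w.asIdeal) : ¬ ψ.IsUnramifiedAt w :=
  not_isUnramifiedAt_of_pinned_of_lFunction_eq_zero h2 V s₀ hpin hnd
    (V.LFunction_apply_eq_zero_of_hasAdditiveReductionAt hvp hadd (dvd_refl p))
    (V.LFunction_apply_eq_zero_of_hasAdditiveReductionAt hvp hadd (dvd_pow_self p two_ne_zero)) w hw

end Summit.BirchSwinnertonDyer.BirchSwinnertonDyer.Theorems.PrintCf2.FramePinning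

end
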